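import Summits.ResolutionOfSingularities.ResolutionOfSingularities.Theorems.HomologicalConductorNoZenoRZariskiFactorisation
import Summits.ResolutionOfSingularities.ResolutionOfSingularities.Theorems.HomologicalConductorNoZenoRZariskiDomination
import HarnessLib

/-!
# Crux `NoZenoR` (stmt-ResolutionOfSingularities-19943) — WEAK FACTORISATION for desingularizations of a normal
# surface singularity: any two desingularizations are dominated by a third through compositions of point blow-ups

Route `ResolutionOfSingularities/HomologicalConductor` (cell decomp-res, hand leafhand-res-homologicalconduct-18 g1).
OURS: AI-written proof over tree theorems, weaker than expert review; nothing here is a statement of the manuscript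
under review (Hironaka 2017).  SUPPORT level, counted 0.  Def-free, no new named facts.

For `S` a two-dimensional Noetherian local normal domain and two desingularizations `f : X → Spec S`,
`g : W → Spec S`:

* `isResolution_comp_of_isResolution` — a desingularization of a desingularization is a desingularization;
* **`exists_common_isPointBlowupComposition`** — there are a scheme `Z`, a composition of point blow-ups
  `j : Z → X` (Lipman's statement B) = Zariski's elimination of indeterminacies by quadratic transformations, hand 18
  g0's `…Lipman12B.exists_isPointBlowupComposition_dominating_of_ringKrullDim_le_two`) and, up to an isomorphism of `Z`,
  a composition of point blow-ups `π' : Z' → W` over the closed point with `Z ⥲ Z' → W → Spec S` equal to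
  `Z → X → Spec S` (the `S`-morphism `Z → W` so obtained is factorised by hand 18 g1's
  `FirstKind.exists_isPointBlowupComposition_of_fac`, Stacks 0C5R).  So any two desingularizations of `Spec S` are
  connected by a finite chain of quadratic transformations and their inverses.

No crux or summit statement is proved here.
-/

noncomputable section

-- single-problem summit: the doubled namespace component `ResolutionOfSingularities` is forced
set_option linter.dupNamespace false

open CategoryTheory AlgebraicGeometry TopologicalSpace Topology IsLocalRing
open Literature.AlgebraicGeometry.Resolution
open Scheme.IdealSheafData

universe u

namespace Summit.ResolutionOfSingularities.ResolutionOfSingularities.Theorems.NoZeno.FirstKind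

/-- **A desingularization of a desingularization is a desingularization**: `j : Z → X` and `f : X → B` proper
birational with regular sources ⇒ `j ≫ f` proper, birational (`IsBirational.comp`), with regular source. [folklore] -/
theorem isResolution_comp_of_isResolution {Z X B : Scheme.{u}} {j : Z ⟶ X} {f : X ⟶ B}
    (hj : IsResolution j) (hf : IsResolution f) : IsResolution (j ≫ f) := by
  haveI : IsProper j := hj.isProper
  haveI : IsProper f := hf.isProper
  exact ⟨inferInstance, hj.isBirational.comp hf.isBirational, hj.isRegular⟩

variable {S : Type} [CommRing S] [IsNoetherianRing S] [IsLocalRing S] [IsDomain S] [IsIntegrallyClosed S]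

/-- **Weak factorisation for desingularizations of a normal surface singularity.**  For `S` a two-dimensional
Noetherian local normal domain and desingularizations `f : X → Spec S`, `g : W → Spec S`, there are `Z`, a composition
of point blow-ups `j : Z → X`, an isomorphism `e : Z ⥲ Z'` and a composition `π' : Z' → W` of blowings up at closed
points over the closed point of `S` with `e ≫ π' ≫ g = j ≫ f`: the two desingularizations are connected by quadratic
transformations and their inverses (Lipman's statement B) followed by Zariski's factorisation of the resulting
`S`-morphism `Z → W`). [cite: Lipman1969, Proposition (1.2), proof, statement B) (p. 200) and Theorem (4.1) (p. 204)];
[cite: StacksProject, Tag 0C5R] -/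
theorem exists_common_isPointBlowupComposition (h2 : ringKrullDim S = 2) {X W : Scheme.{0}}
    {f : X ⟶ Spec (.of S)} {g : W ⟶ Spec (.of S)} (hf : IsResolution f) (hg : IsResolution g) :
    ∃ (Z : Scheme.{0}) (j : Z ⟶ X) (T : Set X) (Z' : Scheme.{0}) (e : Z ⟶ Z') (_ : IsIso e) (π' : Z' ⟶ W),
      IsPointBlowupComposition T j ∧ IsPointBlowupComposition (g.base ⁻¹' {closedPoint S}) π' ∧
        e ≫ π' ≫ g = j ≫ f := by
  haveI : IsIntegral W := hg.isIntegral_source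
  haveI : IsProper g := hg.isProper
  obtain ⟨Z, j, h, T, hj, hjres, hfac⟩ :=
    Lipman12B.exists_isPointBlowupComposition_dominating_of_ringKrullDim_le_two h2.le f hf g hg.isBirational
  have hres : IsResolution (j ≫ f) := isResolution_comp_of_isResolution hjres hf
  obtain ⟨Z', e, he, π', hπ', heπ⟩ := exists_isPointBlowupComposition_of_fac h2 hres W g h hg hfac
  exact ⟨Z, j, T, Z', e, he, π', hj, hπ', by rw [← Category.assoc, heπ, hfac]⟩

end Summit.ResolutionOfSingularities.ResolutionOfSingularities.Theorems.NoZeno.FirstKind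

end
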